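import Summits.CriticalPhenomena.CardyFormulaZ2.Theorems.CardyBoundaryCoulombGasHalfPlaneMarkDensityLawSelfDualityExact
import Summits.CriticalPhenomena.CardyFormulaZ2.Theorems.CardyBoundaryCoulombGasHalfPlaneMarkDensityLawWindowSecondMark
import Summits.CriticalPhenomena.CardyFormulaZ2.Theorems.CardyBoundaryCoulombGasHalfPlaneMarkDensityLawNearEndRegularity
import Literature.Probability.Percolation.ClusterBoundary
import Literature.Probability.Percolation.LatticeSymmetry

/-!
# Lead's skeleton (c12-0), cycle 5: **POSITIVITY OF THE NEAR-END MARK DENSITY** — `∂₂G > 0` and `∂₃G < 0`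
# at EVERY chamber point (crux `HalfPlaneMarkDensityLaw`, line `Sketch`; separation-free, after cycle 4)

The near-end first-hit event `NE_n = firstHit halfPlane C_n ⌊an⌋ ⌊bn⌋` (`C_n = [⌊cn⌋,⌊yn⌋]×{0}` lies to the
RIGHT of the point `(⌊bn⌋,0)`, the excluded arc `[⌊an⌋,⌊bn⌋)×{0}` to its LEFT) is the lattice derivative of
`P_n(a,b,c,y)` in the second mark; `θ j · P[NE_{θ j}] → ∂₂G(a,b,c,y)` (c4-0, `NearEnd.hasDerivAt_jointLimit_second`).
Claim: `n · P[NE_n] ≥ c > 0` eventually.  Same two moves as cycle 4 (`Lines/Sketch_Positivity2.lean`), mirrored: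
* COUNTING for `NR(k; rlo, rhi; slo)` = "the `H`-cluster of `(k,0)` has a bottom point in `[rlo,rhi]` and none in
  `[slo,k)`": on the SECOND-mark window event (`Window.stub_window2_lowerBound`: the leftmost point of a stretch
  joined to an arc `B` on its right falls in a prescribed window) the leftmost joined point `k*` satisfies
  `NR(k*; B; ℓ)`; translates cover ⇒ `P[NR] ≳ 1/n`;
* DECOUPLING by the law of the `H`-cluster `S` of `(k,0)` (toolkit of cycle 4): on `NR ∩ {cluster = S}` the event
  `NE` fails only through an open path of `H` OFF `S` from `[⌊an⌋,k)×{0}` to `C_n`, independent of `S`, of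
  probability `≤ P_n(a,b,c,y) ≤ 1 − c₁` (`Window.stub_eventually_le_one_sub`).
Consequences: `∂₂G > 0`, and by reflection `∂₃G < 0`, everywhere — with cycle 4, ALL FOUR partial derivatives of
every joint subsequential limit are nonzero at every chamber point.
-/

noncomputable section

namespace Summit.CriticalPhenomena.CardyFormulaZ2.Cruxes.HalfPlaneMarkDensityLaw.SketchLine

open Literature.Probability.Percolation Literature.Probability.LatticeModels
open MeasureTheory Filter Set SimpleGraph
open scoped Topology
open Summit.CriticalPhenomena.CardyFormulaZ2.Theorems.HalfPlaneMarkDensityLaw.Negative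

namespace NearEndPos

/-- STUB N1 (deterministic counting inclusion): on the second-mark window event (some point of `[ℓ,m₂]×{0}` joined inside `H` to `B = [lo,hi]×{0}`, none of `[ℓ,m₁]×{0}`), the leftmost joined point `k ∈ (m₁,m₂]` is joined to a point of `B` and to no point of `[ℓ,k)×{0}`. [folklore] -/
theorem stub_nearRight_of_window2 :
    ∀ (ω : BondConfig (Site 2)) (ℓ m₁ m₂ lo hi : ℤ),
      ω ∈ openCrossing halfPlane (rowIcc ℓ m₂) (rowIcc lo hi) \ openCrossing halfPlane (rowIcc ℓ m₁) (rowIcc lo hi) →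
      ∃ k : ℤ, m₁ < k ∧ k ≤ m₂ ∧
        ω ∈ {ω : BondConfig (Site 2) | (∃ r : ℤ, lo ≤ r ∧ r ≤ hi ∧ ω ∈ openConnIn halfPlane (bpt (k)) (bpt r)) ∧ ∀ s : ℤ, ℓ ≤ s → s < k → ω ∉ openConnIn halfPlane (bpt (k)) (bpt s)} := by
  sorry

/-- STUB N2 (translation invariance of the `NR` event). [folklore] -/
theorem stub_nearRight_shift :
    ∀ (k rlo rhi slo : ℤ),
      μ.real {ω : BondConfig (Site 2) | (∃ r : ℤ, rlo + k ≤ r ∧ r ≤ rhi + k ∧ ω ∈ openConnIn halfPlane (bpt (k)) (bpt r)) ∧ ∀ s : ℤ, slo + k ≤ s → s < k → ω ∉ openConnIn halfPlane (bpt (k)) (bpt s)} =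
      μ.real {ω : BondConfig (Site 2) | (∃ r : ℤ, rlo ≤ r ∧ r ≤ rhi ∧ ω ∈ openConnIn halfPlane (bpt (0)) (bpt r)) ∧ ∀ s : ℤ, slo ≤ s → s < 0 → ω ∉ openConnIn halfPlane (bpt (0)) (bpt s)} := by
  sorry

/-- STUB N3: **`n · P[NR(⌊bn⌋; ⌊cn⌋, ⌊yn⌋; ⌊an⌋)] ≥ c₀ > 0` eventually** (`a < b < c < y`). [folklore] -/
theorem stub_nearRight_lowerBound :
    ∀ (a b c y : ℝ), a < b → b < c → c < y → ∃ c₀ : ℝ, 0 < c₀ ∧ ∀ᶠ n : ℕ in atTop,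
      c₀ ≤ (n : ℝ) * μ.real {ω : BondConfig (Site 2) | (∃ r : ℤ, ⌊c * n⌋ ≤ r ∧ r ≤ ⌊y * n⌋ ∧ ω ∈ openConnIn halfPlane (bpt (⌊b * n⌋)) (bpt r)) ∧ ∀ s : ℤ, ⌊a * n⌋ ≤ s → s < ⌊b * n⌋ → ω ∉ openConnIn halfPlane (bpt (⌊b * n⌋)) (bpt s)} := by
  sorry

/-- STUB N4 (deterministic): if the `H`-cluster of `(k,0)` is `S`, `S` has a bottom point in `[clo,chi]` and none in `[alo,k)`, and no open path of `H` off `S` joins `[alo,k)×{0}` to `[clo,chi]×{0}`, then `firstHit halfPlane ([clo,chi]×{0}) alo k` holds. [folklore] -/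
theorem stub_nearEnd_of_hCluster :
    ∀ (ω : BondConfig (Site 2)) (S : Finset (Site 2)) (k alo clo chi : ℤ), ω ⊆ (zdGraph 2).edgeSet →
      alo ≤ k → k < clo → clo ≤ chi → (∃ r : ℤ, clo ≤ r ∧ r ≤ chi ∧ bpt r ∈ S) → (∀ s : ℤ, alo ≤ s → s < k → bpt s ∉ S) →
      ω ∈ {ω : BondConfig (Site 2) | openCluster (ω ∩ {e : Sym2 (Site 2) | ∀ v ∈ e, v ∈ halfPlane}) (bpt (k)) = ↑S} →
      ω ∉ (⋃ u ∈ rowIco alo k, ⋃ v ∈ rowIcc clo chi,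
          (openConnIn (halfPlane ∩ (↑S : Set (Site 2))ᶜ) u v : Set (BondConfig (Site 2)))) →
      ω ∈ firstHit halfPlane (rowIcc clo chi) alo k := by
  sorry

/-- STUB N8: **`(1 − q)·P[NR(k; clo, chi; alo)] ≤ P[firstHit halfPlane ([clo,chi]×{0}) alo k]`** if the escape crossing `[alo,k)×{0} ↔ [clo,chi]×{0}` has probability `≤ q`. [folklore] -/
theorem stub_nearEnd_decoupling :
    ∀ (k alo clo chi : ℤ) (q : ℝ), alo ≤ k → k < clo → clo ≤ chi →
      μ.real (openCrossing halfPlane (rowIco alo k) (rowIcc clo chi)) ≤ q →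
      (1 - q) * μ.real {ω : BondConfig (Site 2) | (∃ r : ℤ, clo ≤ r ∧ r ≤ chi ∧ ω ∈ openConnIn halfPlane (bpt (k)) (bpt r)) ∧ ∀ s : ℤ, alo ≤ s → s < k → ω ∉ openConnIn halfPlane (bpt (k)) (bpt s)} ≤
        μ.real (firstHit halfPlane (rowIcc clo chi) alo k) := by
  sorry

/-- STUB N9 (target): **the near-end mark density is bounded below: `n · P[NE_n(a,b,c,y)] ≥ c₁ > 0` eventually.** [folklore] -/
theorem stub_nearEndDensityPositivity :
    ∀ (a b c y : ℝ), a < b → b < c → c < y → ∃ c₁ : ℝ, 0 < c₁ ∧ ∀ᶠ n : ℕ in atTop,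
      c₁ ≤ (n : ℝ) * μ.real (firstHit halfPlane (rowIcc ⌊c * n⌋ ⌊y * n⌋) ⌊a * n⌋ ⌊b * n⌋) := by
  sorry

/-! ### Glue forms (all stubs provable in parallel) -/

/-- STUB N3' (glue): N1, N2 and `Window.stub_window2_lowerBound` give N3. [folklore] -/
theorem stub_nearRight_lowerBound_of :
    (∀ (ω : BondConfig (Site 2)) (ℓ m₁ m₂ lo hi : ℤ),
      ω ∈ openCrossing halfPlane (rowIcc ℓ m₂) (rowIcc lo hi) \ openCrossing halfPlane (rowIcc ℓ m₁) (rowIcc lo hi) →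
      ∃ k : ℤ, m₁ < k ∧ k ≤ m₂ ∧
        ω ∈ {ω : BondConfig (Site 2) | (∃ r : ℤ, lo ≤ r ∧ r ≤ hi ∧ ω ∈ openConnIn halfPlane (bpt (k)) (bpt r)) ∧ ∀ s : ℤ, ℓ ≤ s → s < k → ω ∉ openConnIn halfPlane (bpt (k)) (bpt s)}) →
    (∀ (k rlo rhi slo : ℤ),
      μ.real {ω : BondConfig (Site 2) | (∃ r : ℤ, rlo + k ≤ r ∧ r ≤ rhi + k ∧ ω ∈ openConnIn halfPlane (bpt (k)) (bpt r)) ∧ ∀ s : ℤ, slo + k ≤ s → s < k → ω ∉ openConnIn halfPlane (bpt (k)) (bpt s)} =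
      μ.real {ω : BondConfig (Site 2) | (∃ r : ℤ, rlo ≤ r ∧ r ≤ rhi ∧ ω ∈ openConnIn halfPlane (bpt (0)) (bpt r)) ∧ ∀ s : ℤ, slo ≤ s → s < 0 → ω ∉ openConnIn halfPlane (bpt (0)) (bpt s)}) →
    ∀ (a b c y : ℝ), a < b → b < c → c < y → ∃ c₀ : ℝ, 0 < c₀ ∧ ∀ᶠ n : ℕ in atTop,
      c₀ ≤ (n : ℝ) * μ.real {ω : BondConfig (Site 2) | (∃ r : ℤ, ⌊c * n⌋ ≤ r ∧ r ≤ ⌊y * n⌋ ∧ ω ∈ openConnIn halfPlane (bpt (⌊b * n⌋)) (bpt r)) ∧ ∀ s : ℤ, ⌊a * n⌋ ≤ s → s < ⌊b * n⌋ → ω ∉ openConnIn halfPlane (bpt (⌊b * n⌋)) (bpt s)} := by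
  sorry

/-- STUB N8' (glue): N4 and the `H`-cluster toolkit of cycle 4 (`stub_mem_hCluster_iff`, `stub_hCluster_indep`, `stub_hCluster_measurable`) give N8. [folklore] -/
theorem stub_nearEnd_decoupling_of :
    (∀ (ω : BondConfig (Site 2)) (S : Finset (Site 2)) (k alo clo chi : ℤ), ω ⊆ (zdGraph 2).edgeSet →
      alo ≤ k → k < clo → clo ≤ chi → (∃ r : ℤ, clo ≤ r ∧ r ≤ chi ∧ bpt r ∈ S) → (∀ s : ℤ, alo ≤ s → s < k → bpt s ∉ S) →
      ω ∈ {ω : BondConfig (Site 2) | openCluster (ω ∩ {e : Sym2 (Site 2) | ∀ v ∈ e, v ∈ halfPlane}) (bpt (k)) = ↑S} →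
      ω ∉ (⋃ u ∈ rowIco alo k, ⋃ v ∈ rowIcc clo chi,
          (openConnIn (halfPlane ∩ (↑S : Set (Site 2))ᶜ) u v : Set (BondConfig (Site 2)))) →
      ω ∈ firstHit halfPlane (rowIcc clo chi) alo k) →
    (∀ (ω : BondConfig (Site 2)) (k : ℤ) (v : Site 2), v ∈ openCluster (ω ∩ {e : Sym2 (Site 2) | ∀ v ∈ e, v ∈ halfPlane}) (bpt k) ↔ ω ∈ openConnIn halfPlane (bpt k) v) →
    (∀ (k : ℤ) (S : Finset (Site 2)) (B : Set (BondConfig (Site 2))), DeterminedBy B ((↑S : Set (Site 2))ᶜ).sym2 → MeasurableSet B → μ.real ({ω : BondConfig (Site 2) | openCluster (ω ∩ {e : Sym2 (Site 2) | ∀ v ∈ e, v ∈ halfPlane}) (bpt (k)) = ↑S} ∩ B) = μ.real {ω : BondConfig (Site 2) | openCluster (ω ∩ {e : Sym2 (Site 2) | ∀ v ∈ e, v ∈ halfPlane}) (bpt (k)) = ↑S} * μ.real B) →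
    (∀ (k : ℤ) (S : Finset (Site 2)), MeasurableSet {ω : BondConfig (Site 2) | openCluster (ω ∩ {e : Sym2 (Site 2) | ∀ v ∈ e, v ∈ halfPlane}) (bpt (k)) = ↑S}) →
    ∀ (k alo clo chi : ℤ) (q : ℝ), alo ≤ k → k < clo → clo ≤ chi →
      μ.real (openCrossing halfPlane (rowIco alo k) (rowIcc clo chi)) ≤ q →
      (1 - q) * μ.real {ω : BondConfig (Site 2) | (∃ r : ℤ, clo ≤ r ∧ r ≤ chi ∧ ω ∈ openConnIn halfPlane (bpt (k)) (bpt r)) ∧ ∀ s : ℤ, alo ≤ s → s < k → ω ∉ openConnIn halfPlane (bpt (k)) (bpt s)} ≤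
        μ.real (firstHit halfPlane (rowIcc clo chi) alo k) := by
  sorry

/-- STUB N9' (glue): N3, N8 and `Window.stub_eventually_le_one_sub` give N9. [folklore] -/
theorem stub_nearEndDensityPositivity_of :
    (∀ (a b c y : ℝ), a < b → b < c → c < y → ∃ c₀ : ℝ, 0 < c₀ ∧ ∀ᶠ n : ℕ in atTop,
      c₀ ≤ (n : ℝ) * μ.real {ω : BondConfig (Site 2) | (∃ r : ℤ, ⌊c * n⌋ ≤ r ∧ r ≤ ⌊y * n⌋ ∧ ω ∈ openConnIn halfPlane (bpt (⌊b * n⌋)) (bpt r)) ∧ ∀ s : ℤ, ⌊a * n⌋ ≤ s → s < ⌊b * n⌋ → ω ∉ openConnIn halfPlane (bpt (⌊b * n⌋)) (bpt s)}) →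
    (∀ (k alo clo chi : ℤ) (q : ℝ), alo ≤ k → k < clo → clo ≤ chi →
      μ.real (openCrossing halfPlane (rowIco alo k) (rowIcc clo chi)) ≤ q →
      (1 - q) * μ.real {ω : BondConfig (Site 2) | (∃ r : ℤ, clo ≤ r ∧ r ≤ chi ∧ ω ∈ openConnIn halfPlane (bpt (k)) (bpt r)) ∧ ∀ s : ℤ, alo ≤ s → s < k → ω ∉ openConnIn halfPlane (bpt (k)) (bpt s)} ≤
        μ.real (firstHit halfPlane (rowIcc clo chi) alo k)) →
    ∀ (a b c y : ℝ), a < b → b < c → c < y → ∃ c₁ : ℝ, 0 < c₁ ∧ ∀ᶠ n : ℕ in atTop,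
      c₁ ≤ (n : ℝ) * μ.real (firstHit halfPlane (rowIcc ⌊c * n⌋ ⌊y * n⌋) ⌊a * n⌋ ⌊b * n⌋) := by
  sorry

end NearEndPos

end Summit.CriticalPhenomena.CardyFormulaZ2.Cruxes.HalfPlaneMarkDensityLaw.SketchLine
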